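/-
Copyright (c) 2026 the pub-hodgecm-mathlib formalisation cell (harness21).  Prover seat hodgecm-mathlib-K2E4-p11 (g10) on the S4 valve (dealer K2E2-plan (g8); card asked by the
(J̃♭-Σ) assembler K2E3-p31 (g3) 03:35:36Z (4); two-hand cut with K2E3-p36 (g4) `R90S4TwistedTubeModelGtLocLetters`), road (J̃♭) MODEL, THE DATUM BRIDGE: ★ (M-3b)
`twistedTubeJacobianLocal_model` AT `G := G̃_v = GL₃(L ⊗ L⁺_v)`, `K := L_w`, WITH EVERY MODEL LETTER DISCHARGED — FILE 1∕2: THE WEIGHT LETTERS `hDlc`, `hDval` (`D := cartanWeight ∘ φ`).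
Crux H413 `stmt-HodgeConjecture-24833`, lane `--supports … --as helper` (count-neutral).  THEOREMS ONLY (no `def`, no `instance`, no notation, no named-fact hypothesis, no `sorry`).
-/
import Summits.HodgeConjecture.HodgeConjecture.Theorems.R90S4TwistedJacobianWeight          -- ★ (TJ3) p864488 (R90-C131-p04): `addEquivAddHaarChar_eq_sqrt_normAbs_twisted` (the twisted weight dock, `n = 3`)
import Summits.HodgeConjecture.HodgeConjecture.Theorems.R90S4CartanMeasures                 -- ★ `cartanWeight`, `cartanWeight_of_eq`, `cartanWeight_of_ne` (brings `Gqs`, `GtLoc`, `PlacesOver`, `cmBorelTriple`)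
import Summits.HodgeConjecture.HodgeConjecture.Theorems.F0P3cStCharTSDGLc                   -- ★ DG-LC `dgFormula_eventually_eq` (the closed form is locally constant at regular points)
import Summits.HodgeConjecture.HodgeConjecture.Theorems.F0P3cStCharTSUpTrTubeSocketAnyCartan -- ★ `sqrt_dgRadicand_coe_torus_eq_vanDijkWeight_re_sq` (on the split torus the letter is `(Re Δ)²`)
import Summits.HodgeConjecture.HodgeConjecture.Theorems.F0P3cStCharTSJacCartanWeightDock     -- ★ `discr_map_of_degree_eq_three`
import Summits.HodgeConjecture.HodgeConjecture.Theorems.R90S4CartanNormMap                  -- ★ `mul_comm_of_mem_centralizer_of_isRegularElt`, `epsLoc_mem_centralizer_coe` (brings `GtLoc`, `epsLoc`, `epsNorm`)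
import Literature.NumberTheory.Automorphic.UnitaryGroupInertPlaceHyperbolicBasis              -- ★ `galAdicCompletionMap_galAdicCompletionMap_of_smul_eq` (`σ_w` is an involution)
import Literature.NumberTheory.Automorphic.UnitaryGroupNonsplitPlace                          -- ★ `PlacesOver.subsingleton_of_smul_eq` (one place above a non-split `v`)
import HarnessLib

/-!
# R90-TF · S4 (Ch. 13.1–2) · road (J̃♭) MODEL — THE DATUM BRIDGE, FILE 1∕2 (WEIGHT): the letters `hDlc`, `hDval` of ★ (M-3b) at `D := cartanWeight ∘ φ`

Cell `hodgecm-mathlib`, crux H413 (`stmt-HodgeConjecture-24833`, lane `--supports … --as helper`), route of record `HCCMUnconditional` (no route verbs; count-neutral).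
Programme R90-TF, section S4 = [Rogawski1990] Ch. 13.1–13.2 (twisted Weyl integration formula; §12.5 p. 186: «the Jacobian at `δ` is `D_G(N δ)²`»); seat K2E4-p11 (g10).
ORDER: the (J̃♭-Σ) assembler K2E3-p31 (g3) consumes ★ (M-3b) `R90S4TwistedTubeModel.twistedTubeJacobianLocal_model` (R90-C131-p05) at the datum `G := GtLoc L v`,
`K := w.1.adicCompletion L` (one place `w ∣ v`, `c̄ • w = w`), `ρ` the one-place model (★ SING-ε `localGLPiEquiv ≫ localGLPiEvalEquiv`), `T := A = Cent(γ₀)`, weight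
`D := fun b => cartanWeight L v T (φ b)` for the norm homomorphism `φ : A →* T` (`(φ b).val = N b = b ε(b)`).  This file discharges the two WEIGHT letters of ★ (M-3b):

* §1 `cartanWeight_eq_sqrt_radicand`: on EVERY member `T` of the Cartan system (split `M` included, ★ `sqrt_dgRadicand_coe_torus_eq_vanDijkWeight_re_sq`)
  `cartanWeight T t = √(∏_{w′} |disc χ_t|_{w′} · (∏_{w′} |det t|_{w′})⁻²)`; hence `eventually_cartanWeight_eq_of_isRegularElt` (★ DG-LC `dgFormula_eventually_eq`): the weight is
  locally constant at every regular `t₀` — the letter `hDlc` (before composing with the continuous `φ`).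
* §2 `radicand_eq_normAbs_of_map_eval`: at a non-split `v` the radicand of `g ∈ G̃_v` is `‖−disc χ_{g_w} ∕ det g_w²‖_{L_w}` for the `w`-component `g_w = ρ g` (any `ρ` reading
  matrices entrywise through `π_w`, hypothesis `hρπ`) — ★ WEIGHT-DOCK's dictionary `weightFormula_eq_normAbs_model`, re-run for `ρ`.
* §3 `cartanWeight_eq_addEquivAddHaarChar_of_laws`: the letter `hDval` — for `t ∈ T` with `t = b₀ ε(b₀)`, `b₀ ε(b₀) = ε(b₀) b₀`, `N := ρ(b₀ ε b₀)` regular, and EVERY bi-continuous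
  additive `L_E` of `M₃(L_w)` obeying ★ (TJ3)'s two laws at `N` (`L_E = id` on `𝔷(N)`, `L_E = Ad(b⁻¹) + τ` on `[N, ·]`, `τ X = J⁻¹ (X.map σ_w)ᵀ J`):
  `cartanWeight T t = addEquivAddHaarChar L_E` — ★ (TJ3) `addEquivAddHaarChar_eq_sqrt_normAbs_twisted` (skew unit of `σ_w` supplied by the caller) + §1 + §2.
FILE 2∕2 (`R90S4TwistedTubeModelGtLoc`, same seat: the head `twistedTubeJacobianLocal_model_gtLoc`) feeds these and K2E3-p36 (g4)'s one-place letters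
(`R90S4TwistedTubeModelGtLocLetters`) to ★ (M-3b).

HONEST LABEL: HC_CM is proved only modulo the 7 printed citations (2 remaining named inputs: hLiu418 = `stmt-HodgeConjecture-24832`, h413 = `stmt-HodgeConjecture-24833`)
until rung 0 closes; these letters pay nothing by themselves — the (J̃♭) socket is paid only at K2E3-p31's call (REL ≠ ★ ≠ BUILT; count-neutral).

## References
* [Rogawski1990] J. D. Rogawski, *Automorphic Representations of Unitary Groups in Three Variables*, Ann. of Math. Stud. 123 (1990), §12.5 pp. 182, 186; §4.9 p. 54.
* [HarishChandra1970] Harish-Chandra (notes by G. van Dijk), *Harmonic Analysis on Reductive p-adic Groups*, LNM 162 (1970), Part V §4 Lemma 22. Context locator.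
* [Labesse1999] J.-P. Labesse, *Cohomologie, stabilisation et changement de base*, Astérisque 257 (1999), §III.1. Context locator.
* [CasselsFrohlichANT1967] J. W. S. Cassels, A. Fröhlich (eds.), *Algebraic Number Theory* (1967), Ch. II §10 (completions at one place). Context locator.
-/

set_option autoImplicit false
-- the mandated namespace repeats the single-problem summit's segment (`HodgeConjecture.HodgeConjecture`)
set_option linter.dupNamespace false

open Set Filter MeasureTheory MeasureTheory.Measure TopologicalSpace Topology Matrix Polynomial
open NumberField IsDedekindDomain
open Literature.NumberTheory.Automorphic Literature.NumberTheory.Automorphic.UnitaryGroup Literature.NumberTheory.Rogawski1990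
open Literature.NumberTheory.GaloisRepresentations Literature.NumberTheory.GaloisRepresentations.IsNonarchimedeanLocalField
open Summit.HodgeConjecture.HodgeConjecture.Cruxes.H413
open scoped ENNReal NNReal MatrixGroups

namespace Summit.HodgeConjecture.HodgeConjecture.R90.S4

section Weight

variable (L : Type) [Field L] [NumberField L] [IsCMField L] (v : HeightOneSpectrum (𝓞 ↥(maximalRealSubfield L)))

/-! ## §1 The Weyl weight is the square root of the radicand on every member; local constancy at regular points -/

/-- **`cartanWeight T t = √(∏_{w′} |disc χ_t|_{w′} · (∏_{w′} |det t|_{w′})⁻²)` ON EVERY MEMBER `T` of the Cartan system** (`v` non-split): off the split torus this is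
★ `cartanWeight_of_ne` verbatim; on the split torus `M` the definition reads `(Re Δ(t))²`, which is the same square root by ★ `sqrt_dgRadicand_coe_torus_eq_vanDijkWeight_re_sq`.
[cite: Rogawski1990, §12.5 p. 182; §4.9 p. 54] [cite: HarishChandra1970, Lemma 22] -/
theorem cartanWeight_eq_sqrt_radicand (hns : ∀ w : PlacesOver L v, IsCMField.complexConj L • w.1 = w.1) (T : Subgroup (Gqs L v)) (t : ↥T) :
    cartanWeight L v T t = NNReal.sqrt
      ((∏ w' : PlacesOver L v, normAbs (w'.1.adicCompletion L) ((((t : Gqs L v).val : GL (Fin 3) (UnitaryGroup.LocalRing L v)).val.charpoly.discr) w')) *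
        ((∏ w' : PlacesOver L v, normAbs (w'.1.adicCompletion L) ((((t : Gqs L v).val : GL (Fin 3) (UnitaryGroup.LocalRing L v)).val.det) w')) ^ 2)⁻¹) := by
  classical
  by_cases h : T = (cmBorelTriple L 3 v).M
  · rw [cartanWeight_of_eq L v h]
    have h1 := F0P3cStCharTSUpTrTubeSocketAnyCartan.sqrt_dgRadicand_coe_torus_eq_vanDijkWeight_re_sq L v hns ⟨(t : Gqs L v), h ▸ t.2⟩
    show Real.toNNReal ((F0P3cStCharTSTorusDefs.vanDijkWeight L v ⟨(t : Gqs L v), h ▸ t.2⟩).re ^ 2) = _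
    rw [← h1, Real.toNNReal_coe]
  · rw [cartanWeight_of_ne L v h]

/-- **THE WEYL WEIGHT IS LOCALLY CONSTANT AT EVERY REGULAR POINT OF EVERY MEMBER** (`hDlc` of ★ (M-3b), before composing with `φ`): `|·|_{w′}` takes discrete values off
`0`, `disc χ_{t₀} ≠ 0` — ★ DG-LC `dgFormula_eventually_eq` (the closed form `√√radicand` on `U(Φ₃)(L⁺_v)`), pulled back along `T ↪ U(Φ₃)(L⁺_v)` and un-square-rooted.
[cite: HarishChandra1970, Lemma 22] [cite: Rogawski1990, §4.9 p. 54; §12.5 p. 182] -/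
theorem eventually_cartanWeight_eq_of_isRegularElt (hns : ∀ w : PlacesOver L v, IsCMField.complexConj L • w.1 = w.1) (T : Subgroup (Gqs L v)) (t₀ : ↥T)
    (hreg : IsRegularElt (((t₀ : Gqs L v)).val : GL (Fin 3) (UnitaryGroup.LocalRing L v))) :
    ∀ᶠ t in 𝓝 t₀, cartanWeight L v T t = cartanWeight L v T t₀ := by
  have h := (continuous_subtype_val.tendsto t₀).eventually (F0P3cStCharTSDGLc.dgFormula_eventually_eq L v (t₀ : Gqs L v) hreg)
  filter_upwards [h] with t ht
  rw [cartanWeight_eq_sqrt_radicand L v hns T t, cartanWeight_eq_sqrt_radicand L v hns T t₀]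
  exact NNReal.sqrt.injective (NNReal.coe_injective ht)

/-! ## §2 One place above a non-split `v`: the radicand is `‖−disc χ ∕ det²‖_{L_w}` of the `w`-component -/

variable (w : PlacesOver L v) (hw : IsCMField.complexConj L • w.1 = w.1)

include hw in
/-- **THE RADICAND READ AT THE ONE PLACE `w ∣ v`**: for `g ∈ G̃_v = GL₃(L ⊗ L⁺_v)` and any `ρ : G̃_v → GL₃(L_w)` reading matrices entrywise through the evaluation `π_w`
(`hρπ`; the one-place model `localGLPiEquiv ≫ localGLPiEvalEquiv` satisfies it by `rfl`), `∏_{w′} |disc χ_g|_{w′} (∏_{w′} |det g|_{w′})⁻² = ‖−disc χ_{ρ g} ∕ det(ρ g)²‖_{L_w}`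
(one factor, ★ `PlacesOver.subsingleton_of_smul_eq`; `disc` and `det` commute with `π_w`, ★ `discr_map_of_degree_eq_three`). [cite: Rogawski1990, §4.9 p. 54] [cite: CasselsFrohlichANT1967, Ch. II §10] -/
theorem radicand_eq_normAbs_of_map_eval (ρ : GtLoc L v →* GL (Fin 3) (w.1.adicCompletion L))
    (hρπ : ∀ δ : GtLoc L v, ((ρ δ : GL (Fin 3) (w.1.adicCompletion L)) : Matrix (Fin 3) (Fin 3) (w.1.adicCompletion L)) =
      δ.val.map (Pi.evalRingHom (fun w' : PlacesOver L v => w'.1.adicCompletion L) w))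
    (g : GtLoc L v) :
    (∏ w' : PlacesOver L v, normAbs (w'.1.adicCompletion L) ((g.val.charpoly.discr) w')) *
        ((∏ w' : PlacesOver L v, normAbs (w'.1.adicCompletion L) ((g.val.det) w')) ^ 2)⁻¹ =
      normAbs (w.1.adicCompletion L)
        (-(((ρ g : GL (Fin 3) (w.1.adicCompletion L)) : Matrix (Fin 3) (Fin 3) (w.1.adicCompletion L)).charpoly.discr) /
          ((ρ g : GL (Fin 3) (w.1.adicCompletion L)) : Matrix (Fin 3) (Fin 3) (w.1.adicCompletion L)).det ^ 2) := by
  haveI : Subsingleton (PlacesOver L v) := PlacesOver.subsingleton_of_smul_eq (IsCMField.complexConj L) (IsCMField.complexConj_ne_one L) w hw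
  set ev := Pi.evalRingHom (fun w' : PlacesOver L v => w'.1.adicCompletion L) w with hev
  haveI : Nontrivial (UnitaryGroup.LocalRing L v) := ev.domain_nontrivial
  have hdeg : (g.val : Matrix (Fin 3) (Fin 3) (UnitaryGroup.LocalRing L v)).charpoly.degree = 3 := by
    rw [Matrix.charpoly_degree_eq_dim]; rfl
  have hdeg' : ((g.val : Matrix (Fin 3) (Fin 3) (UnitaryGroup.LocalRing L v)).charpoly.map ev).degree = 3 := by
    rw [← Matrix.charpoly_map, Matrix.charpoly_degree_eq_dim]; rfl
  have hdisc : (((ρ g : GL (Fin 3) (w.1.adicCompletion L)) : Matrix (Fin 3) (Fin 3) (w.1.adicCompletion L))).charpoly.discr = (g.val.charpoly.discr) w := by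
    rw [hρπ, Matrix.charpoly_map, F0P3cStCharTSJacCartanWeightDock.discr_map_of_degree_eq_three ev _ hdeg hdeg', hev, Pi.evalRingHom_apply]
  have hdet : (((ρ g : GL (Fin 3) (w.1.adicCompletion L)) : Matrix (Fin 3) (Fin 3) (w.1.adicCompletion L))).det = (g.val.det) w := by
    rw [hρπ, ← RingHom.mapMatrix_apply, ← RingHom.map_det, hev, Pi.evalRingHom_apply]
  have hneg1 : normAbs (w.1.adicCompletion L) (-1) = 1 := by
    have h := map_mul (normAbs (w.1.adicCompletion L)) (-1) (-1)
    rw [neg_one_mul, neg_neg, map_one] at h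
    have h' : normAbs (w.1.adicCompletion L) (-1) ^ 2 = 1 := by rw [pow_two]; exact h.symm
    exact (pow_eq_one_iff.1 h').resolve_right two_ne_zero
  rw [Fintype.prod_subsingleton _ w, Fintype.prod_subsingleton _ w, hdisc, hdet, neg_div, ← neg_one_mul, map_mul, hneg1, one_mul, map_div₀, map_pow,
    div_eq_mul_inv]

/-! ## §3 The weight at `t = N b₀` is the modulus of every twisted linear part at `N b₀` (`hDval` of ★ (M-3b)) -/

include hw in
/-- **`hDval` — THE WEYL WEIGHT AT `t = b₀ ε(b₀)` IS THE MODULUS OF EVERY TWISTED LINEAR PART AT `N := ρ(b₀ ε b₀)`.**  One place `w ∣ v` above a non-split `v`;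
`σ_w = galAdicCompletionMap` with a skew element `θ ≠ 0` (`σ_w θ = −θ`); `J` invertible with `(J.map σ_w)ᵀ = J`; `ρ` reads matrices through `π_w` (`hρπ`) and reads the twist as
`ρ(b₀ ε b₀) = ρ b₀ · J⁻¹ ((ρ b₀)⁻¹.map σ_w)ᵀ J` (`hN`), commuting factors (`hcomm`), `N` regular (`hsep`).  Then for EVERY bi-continuous additive `L_E` of `M₃(L_w)` with ★ (TJ3)'s
two laws at `N` the weight `cartanWeight T t` of any `t ∈ T` whose matrix is `b₀ ε(b₀)` equals `addEquivAddHaarChar L_E`: ★ (TJ3) `addEquivAddHaarChar_eq_sqrt_normAbs_twisted`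
(`= √‖−disc χ_N ∕ det N²‖_{L_w}`) + §2 + §1.  «`dδ̃ = D_G(N δ)² dδ`.» [cite: Rogawski1990, §12.5 p. 186; §4.9 p. 54] [cite: Labesse1999, §III.1] [cite: HarishChandra1970, Lemma 22] -/
theorem cartanWeight_eq_addEquivAddHaarChar_of_laws (hns : ∀ w : PlacesOver L v, IsCMField.complexConj L • w.1 = w.1)
    [MeasurableSpace (Matrix (Fin 3) (Fin 3) (w.1.adicCompletion L))] [BorelSpace (Matrix (Fin 3) (Fin 3) (w.1.adicCompletion L))]
    [LocallyCompactSpace (Matrix (Fin 3) (Fin 3) (w.1.adicCompletion L))]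
    {θ : w.1.adicCompletion L} (hθ0 : θ ≠ 0) (hθσ : galAdicCompletionMap (L := L) (IsCMField.complexConj L) hw θ = -θ)
    (J : Matrix (Fin 3) (Fin 3) (w.1.adicCompletion L)) (hJ : IsUnit J.det) (hJh : (J.map (galAdicCompletionMap (L := L) (IsCMField.complexConj L) hw))ᵀ = J)
    (ρ : GtLoc L v →* GL (Fin 3) (w.1.adicCompletion L))
    (hρπ : ∀ δ : GtLoc L v, ((ρ δ : GL (Fin 3) (w.1.adicCompletion L)) : Matrix (Fin 3) (Fin 3) (w.1.adicCompletion L)) =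
      δ.val.map (Pi.evalRingHom (fun w' : PlacesOver L v => w'.1.adicCompletion L) w))
    (b₀ n₀ : GtLoc L v)
    (hN : ((ρ n₀ : GL (Fin 3) (w.1.adicCompletion L)) : Matrix (Fin 3) (Fin 3) (w.1.adicCompletion L)) =
      ((ρ b₀ : GL (Fin 3) (w.1.adicCompletion L)) : Matrix (Fin 3) (Fin 3) (w.1.adicCompletion L)) *
        (J⁻¹ * ((((ρ b₀)⁻¹ : GL (Fin 3) (w.1.adicCompletion L)) : Matrix (Fin 3) (Fin 3) (w.1.adicCompletion L)).map
          (galAdicCompletionMap (L := L) (IsCMField.complexConj L) hw))ᵀ * J))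
    (hcomm : ((ρ b₀ : GL (Fin 3) (w.1.adicCompletion L)) : Matrix (Fin 3) (Fin 3) (w.1.adicCompletion L)) *
        (J⁻¹ * ((((ρ b₀)⁻¹ : GL (Fin 3) (w.1.adicCompletion L)) : Matrix (Fin 3) (Fin 3) (w.1.adicCompletion L)).map
          (galAdicCompletionMap (L := L) (IsCMField.complexConj L) hw))ᵀ * J) =
      (J⁻¹ * ((((ρ b₀)⁻¹ : GL (Fin 3) (w.1.adicCompletion L)) : Matrix (Fin 3) (Fin 3) (w.1.adicCompletion L)).map
          (galAdicCompletionMap (L := L) (IsCMField.complexConj L) hw))ᵀ * J) *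
        ((ρ b₀ : GL (Fin 3) (w.1.adicCompletion L)) : Matrix (Fin 3) (Fin 3) (w.1.adicCompletion L)))
    (hsep : (((ρ n₀ : GL (Fin 3) (w.1.adicCompletion L)) : Matrix (Fin 3) (Fin 3) (w.1.adicCompletion L))).charpoly.Separable)
    (T : Subgroup (Gqs L v)) (t : ↥T) (ht : (((t : Gqs L v)).val : GtLoc L v) = n₀)
    (LE : Matrix (Fin 3) (Fin 3) (w.1.adicCompletion L) ≃ₜ+ Matrix (Fin 3) (Fin 3) (w.1.adicCompletion L))
    (hLz : ∀ X : Matrix (Fin 3) (Fin 3) (w.1.adicCompletion L),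
      X * ((ρ n₀ : GL (Fin 3) (w.1.adicCompletion L)) : Matrix (Fin 3) (Fin 3) (w.1.adicCompletion L)) =
        ((ρ n₀ : GL (Fin 3) (w.1.adicCompletion L)) : Matrix (Fin 3) (Fin 3) (w.1.adicCompletion L)) * X → LE X = X)
    (hLm : ∀ X Y : Matrix (Fin 3) (Fin 3) (w.1.adicCompletion L),
      X = ((ρ n₀ : GL (Fin 3) (w.1.adicCompletion L)) : Matrix (Fin 3) (Fin 3) (w.1.adicCompletion L)) * Y *
            (((ρ n₀)⁻¹ : GL (Fin 3) (w.1.adicCompletion L)) : Matrix (Fin 3) (Fin 3) (w.1.adicCompletion L)) - Y →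
        LE X = (((ρ b₀)⁻¹ : GL (Fin 3) (w.1.adicCompletion L)) : Matrix (Fin 3) (Fin 3) (w.1.adicCompletion L)) * X *
            ((ρ b₀ : GL (Fin 3) (w.1.adicCompletion L)) : Matrix (Fin 3) (Fin 3) (w.1.adicCompletion L)) +
          J⁻¹ * (X.map (galAdicCompletionMap (L := L) (IsCMField.complexConj L) hw))ᵀ * J) :
    ((cartanWeight L v T t : ℝ≥0) : ℝ≥0∞) = addEquivAddHaarChar LE := by
  haveI : Algebra.IsQuadraticExtension ↥(maximalRealSubfield L) L := IsCMField.isQuadraticExtension L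
  have hσc := continuous_galAdicCompletionMap L (IsCMField.complexConj L) hw
  have hσ2 : ∀ a, galAdicCompletionMap (L := L) (IsCMField.complexConj L) hw (galAdicCompletionMap (L := L) (IsCMField.complexConj L) hw a) = a :=
    fun a => galAdicCompletionMap_galAdicCompletionMap_of_smul_eq (IsCMField.complexConj L) w (IsCMField.complexConj_ne_one L) hw a
  rw [addEquivAddHaarChar_eq_sqrt_normAbs_twisted (galAdicCompletionMap (L := L) (IsCMField.complexConj L) hw) hσc hσ2 hθ0 hθσ J hJ hJh (ρ b₀) (ρ n₀) hN hcomm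
    hsep LE hLz hLm, cartanWeight_eq_sqrt_radicand L v hns T t, ht, radicand_eq_normAbs_of_map_eval L v w hw ρ hρπ n₀]

end Weight

end Summit.HodgeConjecture.HodgeConjecture.R90.S4
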